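import Literature.NumberTheory.Transcendental.LWMeasureAlgebraicData
import Literature.NumberTheory.Transcendental.IntegerTaylor
import Literature.NumberTheory.Transcendental.BakerLogarithms
import HarnessLib

/-!
# The auxiliary polynomials of the Lindemann–Weierstrass measure (Ably 1994, §II, 1er pas and the modification) — construction

`Literature/NumberTheory/Transcendental/LWMeasureConstruction.lean` — definitions with bodies and
proofs, no named facts. Second file (after `LWMeasureAlgebraicData.lean`) of the proof of the
"Proposition principale" (§II of M. Ably, Acta Arith. 67 (1994), pp. 33–41) behind the named
fact `Ably1994_lindemannWeierstrass_measure` (`LindemannWeierstrassMeasure.lean`): Gel'fond's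
method with derivatives for the auxiliary function `f(z) = ∑_{β<L, γ<D} p_{β,γ} z^β e^{γz}`
interpolated at the points `h·y = h₁y₁ + ⋯ + hₙyₙ`, `h ∈ [0,M)ⁿ` — "une variante du schéma de
Diaz". The construction is run in `ℤ[w, X₁, …, Xₙ]` (`MvPolynomial (Fin (n+1)) ℤ`, letter
`w = X₀` for the integral generator `α` of `K = ℚ(y)`, letters `Xⱼ` for `e^{yⱼ}`), so that the
tree's criterion over `ℚ` (`QuantCIA.exists_const_polynomial_measure`) applies to the family at
the point `(α, e^{y₁}, …, e^{yₙ})`.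

Contents (everything PROVED; `Setup` bundles the standing data `y, α, Rᵢ, c, μ`):

* `toW` — `p(w)` for `p ∈ ℤ[X]` (`aeval_cons_toW`, `coeff_single_toW`,
  `eq_single_of_mem_support_toW`, `l1_toW_le`, `totalDegree_toW_le`); exponent vectors `consExp`.
* `Setup.E`, `Setup.Mt` — the lifted value polynomials
  `M̃_{β,γ,h,s} = ∑_{s'≤s} C(s,s') β^{(s')} γ^{s−s'} red_μ(c^{L−(β−s')}(∑hⱼRⱼ)^{β−s'})(w) X^{γh}`,
  Ably's `M_{β,γ,h,s}(Y) = Δ_s M_{β,γ}(h·y, ∏Yⱼ^{hⱼ})` (p. 34) with `(h·y)^{β−s'}` replaced by a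
  reduced integer polynomial in `w` and denominators cleared by `c^L`; `Setup.aeval_Mt`:
  `M̃(α, z) = c^L ∑ C(s,s') β^{(s')} (h·y)^{β−s'} γ^{s−s'} (∏ zⱼ^{hⱼ})^γ`; sizes `l1_Mt_le`
  (`≤ (β+γ)^s K₁(M)^L`), `mem_support_Mt` (`w`-degree `< d = deg μ`), `totalDegree_Mt_le`.
* `Setup.P`, `Setup.Q` — the unknown `P_{β,γ} ∈ ℤ[X]` (box of side `b`) and
  `Q_{s,h} = ∑ P_{β,γ} M̃_{β,γ,h,s}`; `mem_support_Q`, `coeff_Q`; **Lemme 1** = `exists_coeffs`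
  (Siegel's lemma over `ℤ`, `Baker1975.lemma1`, for the system "`Q_{s,h} = 0` identically",
  `h ∈ [0,M)ⁿ`, `s < T'`, under (C₁) `2Mⁿ T' d (b+DM)ⁿ ≤ L D bⁿ`; entries `≤ (L+D)^{T'} K₁(M)^L`,
  `abs_mat_le`) — the identical vanishing in `ℤ[w, X]` replaces Ably's Siegel lemma over `K`.
* `Setup.Pj`, `Setup.Qj`, `Setup.IsMinIdx`, `exists_isMinIdx`, `aeval_Qj_eq_zero_of_isMinIdx` —
  the "modification" (Diaz's device of the minimal Taylor index, p. 36, via `IntegerTaylor.lean`)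
  and the exact vanishing `Q_{s,h,j}(x̃) = 0` at the perturbed point (Lemme 2, p. 37, first line
  of its proof); sizes `totalDegree_Qj_le`, `l1_Qj_le`, `degree_le_of_isMinIdx`.

## References

* [Ably1994] M. Ably, *Une version quantitative du théorème de Lindemann–Weierstrass*, Acta Arith.
  67 (1994) 29–45, §II pp. 33–37 and (9), (10) p. 41.
* [Diaz1989] G. Diaz, *Grands degrés de transcendance pour des familles d'exponentielles*,
  J. Number Theory 31 (1989), §II-3-1 (the modification).
* [BakerTNT1975] A. Baker, *Transcendental Number Theory* (1975), Ch. 2, Lemma 1 (Siegel).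
-/

noncomputable section

open scoped Polynomial
open MvPolynomial Finset Finsupp

namespace Literature.NumberTheory.Transcendental

namespace LWMeasure

open Chudnovsky (zl1 l1 wnorm wnorm_mul_le wnorm_sum_le le_wnorm wnorm_monomial pl1Seminorm_apply
  pwnorm normRingSeminorm_int_apply wnorm_nonneg)
open Taylor

/-! ### The standing data -/

/-- **The data of the construction** (Ably 1994, §II, first paragraph, in the tree's `ℚ`-setting):
`ℚ`-linearly independent algebraic `y₁, …, yₙ` (`n ≥ 1`), an algebraic integer `α` generating
`ℚ(y₁, …, yₙ)` with `c yᵢ = Rᵢ(α)` (`c ∈ ℤ ∖ 0`, `Rᵢ ∈ ℤ[X]`; `LWMeasure.exists_generator`) and a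
monic `μ ∈ ℤ[X]` of positive degree with `μ(α) = 0`. A bookkeeping device with a body, not a
hypothesis. [cite: Ably1994, §II p. 33] -/
structure Setup where
  /-- the number of exponents -/
  n : ℕ
  one_le_n : 1 ≤ n
  /-- the algebraic numbers `y₁, …, yₙ` -/
  y : Fin n → ℂ
  alg : ∀ i, IsAlgebraic ℚ (y i)
  li : LinearIndependent ℚ y
  /-- an integral generator of `ℚ(y)` -/
  α : ℂ
  /-- numerators: `c yᵢ = Rᵢ(α)` -/
  R : Fin n → ℤ[X]
  /-- the common denominator -/
  c : ℤ
  /-- a monic integer polynomial vanishing at `α` -/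
  μ : ℤ[X]
  c_ne : c ≠ 0
  μ_monic : μ.Monic
  μ_pos : 0 < μ.natDegree
  μ_root : Polynomial.aeval α μ = 0
  cy_eq : ∀ i, (c : ℂ) * y i = Polynomial.aeval α (R i)

/-! ### Univariate polynomials in the letter `w = X₀` -/

/-- `p(w) ∈ ℤ[w, X₁, …, Xₙ]` for `p ∈ ℤ[X]`: the letter `w = X₀` carries the generator `α`.
[folklore] -/
def toW (n : ℕ) (p : ℤ[X]) : MvPolynomial (Fin (n + 1)) ℤ :=
  Polynomial.aeval (X 0 : MvPolynomial (Fin (n + 1)) ℤ) p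

/-- `toW` as a sum of monomials `w^k`. [folklore] -/
theorem toW_eq_sum (n : ℕ) (p : ℤ[X]) :
    toW n p = ∑ k ∈ p.support, monomial (Finsupp.single 0 k) (p.coeff k) := by
  unfold toW
  rw [Polynomial.aeval_def, Polynomial.eval₂_eq_sum, Polynomial.sum_def]
  refine sum_congr rfl fun k _ => ?_
  rw [eq_intCast, ← C_mul_X_pow_eq_monomial,
    eq_intCast (C : ℤ →+* MvPolynomial (Fin (n + 1)) ℤ) (p.coeff k)]

/-- `toW` is a ring homomorphism (it is `Polynomial.aeval`). [folklore] -/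
theorem toW_mul (n : ℕ) (p q : ℤ[X]) : toW n (p * q) = toW n p * toW n q := map_mul _ _ _

/-- Evaluation: `p(w)` at `(a, z)` is `p(a)`. [folklore] -/
theorem aeval_cons_toW (n : ℕ) (a : ℂ) (z : Fin n → ℂ) (p : ℤ[X]) :
    aeval (Fin.cons a z : Fin (n + 1) → ℂ) (toW n p) = Polynomial.aeval a p := by
  unfold toW
  rw [← Polynomial.aeval_algHom_apply, aeval_X, Fin.cons_zero]

/-- The coefficients of `toW n p`. [folklore] -/
theorem coeff_toW (n : ℕ) (p : ℤ[X]) (m : Fin (n + 1) →₀ ℕ) :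
    coeff m (toW n p) = ∑ k ∈ p.support, if Finsupp.single 0 k = m then p.coeff k else 0 := by
  rw [toW_eq_sum, coeff_sum]
  exact sum_congr rfl fun k _ => by rw [coeff_monomial]

/-- The coefficient of `w^k`. [folklore] -/
theorem coeff_single_toW (n : ℕ) (p : ℤ[X]) (k : ℕ) :
    coeff (Finsupp.single 0 k) (toW n p) = p.coeff k := by
  classical
  rw [coeff_toW]
  rw [Finset.sum_eq_single k]
  · rw [if_pos rfl]
  · intro k' _ hk'
    rw [if_neg]
    intro h
    exact hk' (Finsupp.single_injective 0 h)
  · intro hk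
    rw [if_pos rfl]
    exact Polynomial.notMem_support_iff.mp hk

/-- The monomials of `toW n p` are the `w^k`, `k ≤ deg p`. [folklore] -/
theorem eq_single_of_mem_support_toW (n : ℕ) (p : ℤ[X]) {m : Fin (n + 1) →₀ ℕ}
    (hm : m ∈ (toW n p).support) : ∃ k, k ≤ p.natDegree ∧ m = Finsupp.single 0 k := by
  rw [MvPolynomial.mem_support_iff, coeff_toW] at hm
  obtain ⟨k, hk, hne⟩ := Finset.exists_ne_zero_of_sum_ne_zero hm
  refine ⟨k, Polynomial.le_natDegree_of_mem_supp k hk, ?_⟩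
  by_contra h
  exact hne (if_neg (Ne.symm h))

/-- `‖p(w)‖₁ ≤ ‖p‖₁`. [folklore] -/
theorem l1_toW_le (n : ℕ) (p : ℤ[X]) : l1 (toW n p) ≤ zl1 p := by
  rw [toW_eq_sum]
  refine (wnorm_sum_le _ _ _).trans (le_of_eq ?_)
  rw [pl1Seminorm_apply, pwnorm]
  exact sum_congr rfl fun k _ => by rw [wnorm_monomial]

/-- `deg p(w) ≤ deg p`. [folklore] -/
theorem totalDegree_toW_le (n : ℕ) (p : ℤ[X]) : (toW n p).totalDegree ≤ p.natDegree := by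
  rw [toW_eq_sum]
  refine (totalDegree_finsetSum _ _).trans (Finset.sup_le fun k hk => ?_)
  refine (totalDegree_monomial_le _ _).trans ?_
  rw [Finsupp.sum_single_index rfl]
  exact Polynomial.le_natDegree_of_mem_supp k hk

/-! ### Exponent vectors -/

/-- The exponent vector `(0, v₁, …, vₙ)` (no `w`). [folklore] -/
def consExp {n : ℕ} (e₀ : ℕ) (v : Fin n → ℕ) : Fin (n + 1) →₀ ℕ :=
  equivFunOnFinite.symm (Fin.cons e₀ v)

/-- `consExp` at `0`. [folklore] -/
@[simp] theorem consExp_zero {n : ℕ} (e₀ : ℕ) (v : Fin n → ℕ) : consExp e₀ v 0 = e₀ := by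
  simp [consExp]

/-- `consExp` at `j.succ`. [folklore] -/
@[simp] theorem consExp_succ {n : ℕ} (e₀ : ℕ) (v : Fin n → ℕ) (j : Fin n) :
    consExp e₀ v j.succ = v j := by
  simp [consExp]

/-- `consExp` is injective in the tail. [folklore] -/
theorem consExp_injective {n : ℕ} (e₀ : ℕ) : Function.Injective (consExp (n := n) e₀) := by
  intro v v' h
  funext j
  have := congrArg (fun f => f j.succ) h
  simpa using this

/-- `single 0 k + consExp 0 v = consExp k v`. [folklore] -/
theorem single_add_consExp {n : ℕ} (k : ℕ) (v : Fin n → ℕ) :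
    Finsupp.single (0 : Fin (n + 1)) k + consExp 0 v = consExp k v := by
  ext i
  refine Fin.cases ?_ (fun j => ?_) i
  · simp
  · simp [Fin.succ_ne_zero]

/-- The degree of `X^{(e₀,v)}` is `e₀ + ∑ vⱼ`. [folklore] -/
theorem sum_consExp {n : ℕ} (e₀ : ℕ) (v : Fin n → ℕ) :
    ((consExp e₀ v).sum fun _ e => e) = e₀ + ∑ j, v j := by
  rw [Finsupp.sum_fintype _ _ (fun _ => rfl), Fin.sum_univ_succ]
  simp

/-- The degree of `X^{(e₀,v)}` is `e₀ + ∑ vⱼ` (the form produced by `totalDegree_monomial_le`).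
[folklore] -/
theorem sum_consExp' {n : ℕ} (e₀ : ℕ) (v : Fin n → ℕ) :
    ((consExp e₀ v).sum fun _ => id) = e₀ + ∑ j, v j := sum_consExp e₀ v

/-- The value of the monomial `X^{(0,v)}` at `(a, z)` is `∏ zⱼ^{vⱼ}`. [folklore] -/
theorem aeval_cons_monomial_consExp {n : ℕ} (a : ℂ) (z : Fin n → ℂ) (v : Fin n → ℕ) :
    aeval (Fin.cons a z : Fin (n + 1) → ℂ) (monomial (consExp 0 v) (1 : ℤ)) = ∏ j, z j ^ v j := by
  rw [aeval_monomial, map_one, one_mul, Finsupp.prod_fintype _ _ (fun i => by simp),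
    Fin.prod_univ_succ]
  simp

namespace Setup

variable (S : Setup)

/-- The degree `d = deg μ` of the generator. [folklore] -/
def d : ℕ := S.μ.natDegree

/-- `d ≥ 1`. [folklore] -/
theorem one_le_d : 1 ≤ S.d := S.μ_pos

/-- `h·y = ∑ hⱼ yⱼ`, the interpolation points. [cite: Ably1994, §II 1er pas p. 34] -/
def hy (h : Fin S.n → ℕ) : ℂ := ∑ j, (h j : ℂ) * S.y j

/-- `∑ hⱼ Rⱼ ∈ ℤ[X]`: `(∑ hⱼRⱼ)(α) = c · (h·y)`. [folklore] -/
def Rh (h : Fin S.n → ℕ) : ℤ[X] := ∑ j, Polynomial.C (h j : ℤ) * S.R j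

/-- `(∑ hⱼRⱼ)(α) = c (h·y)`. [folklore] -/
theorem aeval_Rh (h : Fin S.n → ℕ) : Polynomial.aeval S.α (S.Rh h) = (S.c : ℂ) * S.hy h := by
  unfold Rh hy
  rw [map_sum, Finset.mul_sum]
  refine sum_congr rfl fun j _ => ?_
  rw [map_mul, Polynomial.aeval_C, algebraMap_int_eq, eq_intCast, ← S.cy_eq j]
  push_cast
  ring

/-- `E_{h,e} = c^{L-e} (∑ hⱼRⱼ)^e ∈ ℤ[X]`: `E_{h,e}(α) = c^L (h·y)^e` for `e ≤ L` (the powers of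
the interpolation points, denominators cleared as on p. 35, "en multipliant par `δ^L`").
[cite: Ably1994, §II Lemme 1 p. 35] -/
def E (L : ℕ) (h : Fin S.n → ℕ) (e : ℕ) : ℤ[X] := Polynomial.C (S.c ^ (L - e)) * S.Rh h ^ e

/-- `E_{h,e}(α) = c^L (h·y)^e` (`e ≤ L`). [folklore] -/
theorem aeval_E {L e : ℕ} (he : e ≤ L) (h : Fin S.n → ℕ) :
    Polynomial.aeval S.α (S.E L h e) = (S.c : ℂ) ^ L * S.hy h ^ e := by
  unfold E
  rw [map_mul, Polynomial.aeval_C, algebraMap_int_eq, eq_intCast, map_pow, aeval_Rh, mul_pow,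
    ← mul_assoc, Int.cast_pow, ← pow_add, Nat.sub_add_cancel he]

/-- **The lifted value polynomials**
`M̃_{β,γ,h,s} = ∑_{s' ≤ s} C(s,s') β(β-1)⋯(β-s'+1) γ^{s-s'} · red_μ(E_{h,β-s'})(w) · X^{γh}`
`∈ ℤ[w, X₁, …, Xₙ]` — Ably's `M_{β,γ,h,s}(Y) = Δ_s M_{β,γ}(h·y, ∏ Yᵢ^{hᵢ})`, with the algebraic
numbers `(h·y)^{β-s'}` replaced by reduced integer polynomials in the letter `w`, and multiplied
by `c^L`. [cite: Ably1994, §II 1er pas p. 34] -/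
def Mt (L β γ : ℕ) (h : Fin S.n → ℕ) (s : ℕ) : MvPolynomial (Fin (S.n + 1)) ℤ :=
  ∑ s' ∈ range (s + 1), C ((s.choose s' * β.descFactorial s' * γ ^ (s - s') : ℕ) : ℤ) *
    toW S.n (red S.μ (S.E L h (β - s'))) * monomial (consExp 0 fun j => γ * h j) 1

/-- **The value of `M̃_{β,γ,h,s}` at `(α, z)`**:
`c^L ∑_{s'≤s} C(s,s') β(β-1)⋯(β-s'+1) (h·y)^{β-s'} γ^{s-s'} (∏ zⱼ^{hⱼ})^γ`
(`= c^L Δ_s M_{β,γ}(h·y, z^h)`; at `z = e^y`, `z^h = e^{h·y}`). [cite: Ably1994, §II p. 34] -/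
theorem aeval_Mt (z : Fin S.n → ℂ) {L β : ℕ} (hβ : β < L) (γ : ℕ) (h : Fin S.n → ℕ) (s : ℕ) :
    aeval (Fin.cons S.α z : Fin (S.n + 1) → ℂ) (S.Mt L β γ h s) =
      (S.c : ℂ) ^ L * ∑ s' ∈ range (s + 1),
        ((s.choose s' * β.descFactorial s' : ℕ) : ℂ) * S.hy h ^ (β - s') * (γ : ℂ) ^ (s - s') *
          (∏ j, z j ^ h j) ^ γ := by
  unfold Mt
  rw [map_sum, Finset.mul_sum]
  refine sum_congr rfl fun s' _ => ?_
  rw [map_mul, map_mul, aeval_C, algebraMap_int_eq, eq_intCast, aeval_cons_toW,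
    aeval_red _ _ S.μ_root, S.aeval_E (by omega) h, aeval_cons_monomial_consExp]
  have : (∏ j, z j ^ (γ * h j)) = (∏ j, z j ^ h j) ^ γ := by
    rw [← Finset.prod_pow]
    exact prod_congr rfl fun j _ => by rw [← pow_mul, mul_comm]
  rw [this]
  push_cast
  ring


/-! ### Sizes of `M̃` -/

/-- `∑ ‖Rⱼ‖₁`. [folklore] -/
def AR : ℝ := ∑ j, zl1 (S.R j)

/-- `max deg Rⱼ`. [folklore] -/
def dR : ℕ := Finset.univ.sup fun j => (S.R j).natDegree

/-- The base constant of the coefficient growth: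
`K₁(M) = |c| (1 + M ∑‖Rⱼ‖₁) (1 + ‖μ‖₁)^{max deg Rⱼ}`, so that `‖red_μ E_{h,e}‖₁ ≤ K₁(M)^L` for
`e ≤ L`, `max hⱼ ≤ M`. [folklore] -/
def K₁ (M : ℕ) : ℝ := |(S.c : ℝ)| * (1 + M * S.AR) * (1 + zl1 S.μ) ^ S.dR

/-- `AR ≥ 0`. [folklore] -/
theorem AR_nonneg : 0 ≤ S.AR := sum_nonneg fun _ _ => apply_nonneg _ _

/-- `|c| ≥ 1`. [folklore] -/
theorem one_le_abs_c : (1 : ℝ) ≤ |(S.c : ℝ)| := by exact_mod_cast Int.one_le_abs S.c_ne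

/-- `K₁(M) ≥ 1`. [folklore] -/
theorem one_le_K₁ (M : ℕ) : 1 ≤ S.K₁ M := by
  unfold K₁
  have h1 := S.one_le_abs_c
  have h2 : (1 : ℝ) ≤ 1 + M * S.AR :=
    le_add_of_nonneg_right (mul_nonneg (Nat.cast_nonneg _) S.AR_nonneg)
  have h3 : (1 : ℝ) ≤ (1 + zl1 S.μ) ^ S.dR :=
    one_le_pow₀ (le_add_of_nonneg_right (apply_nonneg _ _))
  exact one_le_mul_of_one_le_of_one_le (one_le_mul_of_one_le_of_one_le h1 h2) h3

/-- `K₁` is monotone in `M`. [folklore] -/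
theorem K₁_mono {M M' : ℕ} (h : M ≤ M') : S.K₁ M ≤ S.K₁ M' := by
  unfold K₁
  have hAR := S.AR_nonneg
  have : (M : ℝ) ≤ M' := by exact_mod_cast h
  gcongr

/-- `deg ∑hⱼRⱼ ≤ max deg Rⱼ`. [folklore] -/
theorem natDegree_Rh_le (h : Fin S.n → ℕ) : (S.Rh h).natDegree ≤ S.dR := by
  unfold Rh
  refine (Polynomial.natDegree_sum_le _ _).trans ?_
  rw [Finset.fold_max_le]
  refine ⟨Nat.zero_le _, fun j _ => Polynomial.natDegree_mul_le.trans ?_⟩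
  rw [Polynomial.natDegree_C, zero_add]
  exact Finset.le_sup (f := fun j => (S.R j).natDegree) (mem_univ j)

/-- `‖∑hⱼRⱼ‖₁ ≤ M ∑‖Rⱼ‖₁` for `max hⱼ ≤ M`. [folklore] -/
theorem zl1_Rh_le {M : ℕ} {h : Fin S.n → ℕ} (hh : ∀ j, h j ≤ M) : zl1 (S.Rh h) ≤ M * S.AR := by
  unfold Rh AR
  rw [Finset.mul_sum, pl1Seminorm_apply]
  refine (Chudnovsky.pwnorm_sum_le _ _ _).trans (sum_le_sum fun j _ => ?_)
  have h1 := map_mul_le_mul zl1 (Polynomial.C (h j : ℤ)) (S.R j)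
  rw [Chudnovsky.zl1_C] at h1
  rw [← pl1Seminorm_apply]
  refine h1.trans (mul_le_mul_of_nonneg_right ?_ (apply_nonneg _ _))
  rw [Int.cast_natCast, Nat.abs_cast]
  exact_mod_cast hh j

/-- `deg E_{h,e} ≤ e · max deg Rⱼ`. [folklore] -/
theorem natDegree_E_le (L : ℕ) (h : Fin S.n → ℕ) (e : ℕ) : (S.E L h e).natDegree ≤ e * S.dR := by
  unfold E
  refine Polynomial.natDegree_mul_le.trans ?_
  rw [Polynomial.natDegree_C, zero_add]
  exact Polynomial.natDegree_pow_le.trans (Nat.mul_le_mul_left _ (S.natDegree_Rh_le h))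

/-- `‖E_{h,e}‖₁ ≤ |c|^{L-e} (M ∑‖Rⱼ‖₁)^e` for `max hⱼ ≤ M`. [folklore] -/
theorem zl1_E_le (L : ℕ) {M : ℕ} {h : Fin S.n → ℕ} (hh : ∀ j, h j ≤ M) (e : ℕ) :
    zl1 (S.E L h e) ≤ |(S.c : ℝ)| ^ (L - e) * (M * S.AR) ^ e := by
  unfold E
  refine (map_mul_le_mul zl1 _ _).trans ?_
  rw [Chudnovsky.zl1_C, Int.cast_pow, abs_pow]
  refine mul_le_mul_of_nonneg_left ?_ (pow_nonneg (abs_nonneg _) _)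
  refine (map_pow_le_pow' (f := zl1) (by rw [Chudnovsky.zl1_one]) _ e).trans ?_
  exact pow_le_pow_left₀ (apply_nonneg _ _) (S.zl1_Rh_le hh) e

/-- **`‖red_μ E_{h,e}‖₁ ≤ K₁(M)^L`** for `e ≤ L`, `max hⱼ ≤ M`. [folklore] -/
theorem zl1_red_E_le {L e M : ℕ} (he : e ≤ L) {h : Fin S.n → ℕ} (hh : ∀ j, h j ≤ M) :
    zl1 (red S.μ (S.E L h e)) ≤ S.K₁ M ^ L := by
  have hc := S.one_le_abs_c
  have hAR := S.AR_nonneg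
  have hM : (0 : ℝ) ≤ M := Nat.cast_nonneg _
  have hμ1 : (1 : ℝ) ≤ 1 + zl1 S.μ := le_add_of_nonneg_right (apply_nonneg _ _)
  have hMA : 0 ≤ (M : ℝ) * S.AR := mul_nonneg hM hAR
  have h1 := zl1_red_le_of_natDegree_le S.μ (S.natDegree_E_le L h e)
  have h2 := S.zl1_E_le L hh e
  -- `|c|^{L-e} (M·AR)^e ≤ (|c| (1 + M·AR))^L`
  set B : ℝ := |(S.c : ℝ)| * (1 + M * S.AR) with hB
  have hB1 : |(S.c : ℝ)| ≤ B := le_mul_of_one_le_right (abs_nonneg _) (by linarith)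
  have hB2 : (M : ℝ) * S.AR ≤ B := by
    calc (M : ℝ) * S.AR ≤ 1 * (1 + M * S.AR) := by linarith
      _ ≤ B := mul_le_mul_of_nonneg_right hc (by linarith)
  have h3 : |(S.c : ℝ)| ^ (L - e) * (M * S.AR) ^ e ≤ B ^ L := by
    calc |(S.c : ℝ)| ^ (L - e) * (M * S.AR) ^ e ≤ B ^ (L - e) * B ^ e :=
          mul_le_mul (pow_le_pow_left₀ (abs_nonneg _) hB1 _) (pow_le_pow_left₀ hMA hB2 _)
            (pow_nonneg hMA _) (pow_nonneg (by positivity) _)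
      _ = B ^ L := by rw [← pow_add, Nat.sub_add_cancel he]
  -- `(1+‖μ‖₁)^{e dR} ≤ ((1+‖μ‖₁)^{dR})^L`
  have h4 : (1 + zl1 S.μ) ^ (e * S.dR) ≤ ((1 + zl1 S.μ) ^ S.dR) ^ L := by
    rw [← pow_mul, mul_comm]
    exact pow_le_pow_right₀ hμ1 (Nat.mul_le_mul_left _ he)
  calc zl1 (red S.μ (S.E L h e)) ≤ zl1 (S.E L h e) * (1 + zl1 S.μ) ^ (e * S.dR) := h1
    _ ≤ B ^ L * ((1 + zl1 S.μ) ^ S.dR) ^ L :=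
        mul_le_mul (h2.trans h3) h4 (pow_nonneg (zero_le_one.trans hμ1) _)
          (pow_nonneg (by positivity) _)
    _ = S.K₁ M ^ L := by rw [K₁, ← mul_pow]

/-- The combinatorial factor: `∑_{s' ≤ s} C(s,s') β(β-1)⋯(β-s'+1) γ^{s-s'} ≤ (β + γ)^s`.
[folklore] -/
theorem sum_choose_descFactorial_le (β γ s : ℕ) :
    ∑ s' ∈ range (s + 1), s.choose s' * β.descFactorial s' * γ ^ (s - s') ≤ (β + γ) ^ s := by
  rw [add_pow]
  refine Finset.sum_le_sum fun s' _ => ?_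
  rw [Nat.cast_id]
  calc s.choose s' * β.descFactorial s' * γ ^ (s - s') ≤ s.choose s' * β ^ s' * γ ^ (s - s') :=
        Nat.mul_le_mul (Nat.mul_le_mul_left _ (Nat.descFactorial_le_pow β s')) le_rfl
    _ = β ^ s' * γ ^ (s - s') * s.choose s' := by ring

/-- **`‖M̃_{β,γ,h,s}‖₁ ≤ (β + γ)^s K₁(M)^L`** (`β < L`, `max hⱼ ≤ M`).
[cite: Ably1994, §II Lemme 1 p. 35 (the bound for the conjugates of `m_{β,γ,h,s,j}`)] -/
theorem l1_Mt_le {L β M : ℕ} (hβ : β < L) (γ : ℕ) {h : Fin S.n → ℕ} (hh : ∀ j, h j ≤ M) (s : ℕ) :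
    l1 (S.Mt L β γ h s) ≤ ((β : ℝ) + γ) ^ s * S.K₁ M ^ L := by
  have hK := S.one_le_K₁ M
  unfold Mt
  refine (wnorm_sum_le _ _ _).trans ?_
  have hterm : ∀ s' ∈ range (s + 1),
      l1 (C ((s.choose s' * β.descFactorial s' * γ ^ (s - s') : ℕ) : ℤ) *
        toW S.n (red S.μ (S.E L h (β - s'))) * monomial (consExp 0 fun j => γ * h j) 1) ≤
      ((s.choose s' * β.descFactorial s' * γ ^ (s - s') : ℕ) : ℝ) * S.K₁ M ^ L := by
    intro s' _
    refine (wnorm_mul_le _ _ _).trans ?_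
    rw [wnorm_monomial, Chudnovsky.normRingSeminorm_int_one, mul_one]
    refine (wnorm_mul_le _ _ _).trans ?_
    rw [Chudnovsky.wnorm_C, normRingSeminorm_int_apply, Int.cast_natCast, Nat.abs_cast]
    refine mul_le_mul_of_nonneg_left ?_ (Nat.cast_nonneg _)
    exact (l1_toW_le _ _).trans (S.zl1_red_E_le (by omega) hh)
  refine (Finset.sum_le_sum hterm).trans ?_
  rw [← Finset.sum_mul]
  refine mul_le_mul_of_nonneg_right ?_ (pow_nonneg (zero_le_one.trans hK) _)
  have h' : ((∑ s' ∈ range (s + 1), s.choose s' * β.descFactorial s' * γ ^ (s - s') : ℕ) : ℝ) ≤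
      ((β + γ) ^ s : ℕ) := by exact_mod_cast sum_choose_descFactorial_le β γ s
  push_cast at h' ⊢
  exact h'

/-- **The monomials of `M̃_{β,γ,h,s}`** are `w^k X^{γh}` with `k < d`. [folklore] -/
theorem mem_support_Mt {L β γ : ℕ} {h : Fin S.n → ℕ} {s : ℕ} {m : Fin (S.n + 1) →₀ ℕ}
    (hm : m ∈ (S.Mt L β γ h s).support) : ∃ k, k < S.d ∧ m = consExp k fun j => γ * h j := by
  classical
  unfold Mt at hm
  obtain ⟨s', _, hs'⟩ := Finset.mem_biUnion.mp (support_sum hm)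
  obtain ⟨m₁, hm₁, m₂, hm₂, rfl⟩ := Finset.mem_add.mp (support_mul _ _ hs')
  have hm₁' : m₁ ∈ (toW S.n (red S.μ (S.E L h (β - s')))).support := by
    rw [C_mul'] at hm₁
    exact MvPolynomial.support_smul hm₁
  obtain ⟨k, hk, rfl⟩ := eq_single_of_mem_support_toW _ _ hm₁'
  have hm₂' : m₂ = consExp 0 fun j => γ * h j := by
    have := support_monomial_subset hm₂
    simpa using this
  subst hm₂'
  refine ⟨k, lt_of_le_of_lt hk (natDegree_red_lt S.μ_monic S.μ_pos _), single_add_consExp k _⟩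

/-- **`deg M̃_{β,γ,h,s} ≤ d - 1 + γ ∑ hⱼ`.** [cite: Ably1994, §II p. 35 ("deg M ≤ nDM")] -/
theorem totalDegree_Mt_le (L β γ : ℕ) (h : Fin S.n → ℕ) (s : ℕ) :
    (S.Mt L β γ h s).totalDegree ≤ S.d - 1 + γ * ∑ j, h j := by
  classical
  rw [totalDegree]
  refine Finset.sup_le fun m hm => ?_
  obtain ⟨k, hk, rfl⟩ := S.mem_support_Mt hm
  rw [sum_consExp, ← Finset.mul_sum]
  have := S.one_le_d
  have : k ≤ S.d - 1 := by omega
  exact Nat.add_le_add_right this _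


/-! ### The unknown polynomials `P_{β,γ}` and the derived `Q_{s,h}` -/

/-- Indices of the unknowns: `(β, γ) ∈ [0,L) × [0,D)` and an exponent box `i ∈ [0,b)ⁿ` (the
coefficients `p_{β,γ,i}` of `P_{β,γ}(X) = ∑ p_{β,γ,i} X^i`; Ably sums over `‖i‖ ≤ nDM`, a box
changes only constants). [cite: Ably1994, §II Lemme 1 p. 35] -/
abbrev Unk (n L D b : ℕ) : Type := (Fin L × Fin D) × (Fin n → Fin b)

/-- An index vector as natural numbers. [folklore] -/
def natOf {p K : ℕ} (v : Fin p → Fin K) : Fin p → ℕ := fun i => (v i : ℕ)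

/-- `natOf v i < K`. [folklore] -/
theorem natOf_lt {p K : ℕ} (v : Fin p → Fin K) (i : Fin p) : natOf v i < K := (v i).isLt

variable {L D b : ℕ}

/-- `P_{β,γ}(X) = ∑_i p_{(β,γ),i} X^i ∈ ℤ[X₁, …, Xₙ] ⊂ ℤ[w, X]` (no `w`).
[cite: Ably1994, §II Lemme 1 p. 35] -/
def P (p : Unk S.n L D b → ℤ) (βγ : Fin L × Fin D) : MvPolynomial (Fin (S.n + 1)) ℤ :=
  ∑ i : Fin S.n → Fin b, monomial (consExp 0 (natOf i)) (p (βγ, i))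

/-- The coefficient of `X^i` in `P_{β,γ}` is the unknown `p_{(β,γ),i}`. [folklore] -/
theorem coeff_P (p : Unk S.n L D b → ℤ) (βγ : Fin L × Fin D) (i : Fin S.n → Fin b) :
    coeff (consExp 0 (natOf i)) (S.P p βγ) = p (βγ, i) := by
  classical
  unfold P
  rw [coeff_sum, Finset.sum_eq_single i]
  · rw [coeff_monomial, if_pos rfl]
  · intro i' _ hne
    rw [coeff_monomial, if_neg]
    intro h
    exact hne (by
      have := consExp_injective 0 h
      funext j
      exact Fin.ext (congrFun this j))
  · intro h
    exact absurd (mem_univ i) h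

/-- If all `P_{β,γ}` vanish then all unknowns vanish. [folklore] -/
theorem eq_zero_of_P_eq_zero {p : Unk S.n L D b → ℤ} (h : ∀ βγ, S.P p βγ = 0) : p = 0 := by
  funext ⟨βγ, i⟩
  have := S.coeff_P p βγ i
  rw [h βγ, coeff_zero] at this
  exact this.symm

/-- The monomials of `P_{β,γ}`: `X^i` with `i` in the box (no `w`). [folklore] -/
theorem mem_support_P (p : Unk S.n L D b → ℤ) (βγ : Fin L × Fin D) {m : Fin (S.n + 1) →₀ ℕ}
    (hm : m ∈ (S.P p βγ).support) : ∃ i : Fin S.n → Fin b, m = consExp 0 (natOf i) := by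
  classical
  rw [MvPolynomial.mem_support_iff] at hm
  unfold P at hm
  rw [coeff_sum] at hm
  obtain ⟨i, _, hi⟩ := Finset.exists_ne_zero_of_sum_ne_zero hm
  rw [coeff_monomial] at hi
  exact ⟨i, by by_contra h'; exact hi (if_neg (Ne.symm h'))⟩

/-- **`Q_{s,h} = ∑_{β,γ} P_{β,γ} M̃_{β,γ,h,s} ∈ ℤ[w, X]`** — the values
`c^L ∑ P_{β,γ}(X) Δ_s M_{β,γ}(h·y, X^h)` of the auxiliary function's derivatives, as polynomials.
[cite: Ably1994, §II Lemme 1 p. 35] -/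
def Q (p : Unk S.n L D b → ℤ) (h : Fin S.n → ℕ) (s : ℕ) : MvPolynomial (Fin (S.n + 1)) ℤ :=
  ∑ βγ : Fin L × Fin D, S.P p βγ * S.Mt L βγ.1 βγ.2 h s

/-- **Support of `Q_{s,h}`**: every monomial is `w^k X^v` with `k < d` and `vⱼ < b + DM`
(`hⱼ < M`). [folklore] -/
theorem mem_support_Q (p : Unk S.n L D b → ℤ) {M : ℕ} {h : Fin S.n → ℕ} (hh : ∀ j, h j < M)
    (s : ℕ) {m : Fin (S.n + 1) →₀ ℕ} (hm : m ∈ (S.Q p h s).support) :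
    m 0 < S.d ∧ ∀ j : Fin S.n, m j.succ < b + D * M := by
  classical
  unfold Q at hm
  obtain ⟨βγ, _, hβγ⟩ := Finset.mem_biUnion.mp (support_sum hm)
  obtain ⟨m₁, hm₁, m₂, hm₂, rfl⟩ := Finset.mem_add.mp (support_mul _ _ hβγ)
  obtain ⟨i, rfl⟩ := S.mem_support_P p βγ hm₁
  obtain ⟨k, hk, rfl⟩ := S.mem_support_Mt hm₂
  refine ⟨by simpa using hk, fun j => ?_⟩
  simp only [Finsupp.add_apply, consExp_succ, natOf]
  have h1 : (i j : ℕ) < b := (i j).isLt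
  have h2 : (βγ.2 : ℕ) * h j ≤ D * M :=
    Nat.mul_le_mul βγ.2.isLt.le (hh j).le
  omega

/-- The coefficients of `Q_{s,h}` are integer linear forms in the unknowns. [folklore] -/
theorem coeff_Q (p : Unk S.n L D b → ℤ) (h : Fin S.n → ℕ) (s : ℕ) (m : Fin (S.n + 1) →₀ ℕ) :
    coeff m (S.Q p h s) = ∑ w : Unk S.n L D b,
      p w * coeff m (monomial (consExp 0 (natOf w.2)) 1 * S.Mt L w.1.1 w.1.2 h s) := by
  unfold Q P
  rw [coeff_sum, Fintype.sum_prod_type (fun w : Unk S.n L D b =>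
    p w * coeff m (monomial (consExp 0 (natOf w.2)) 1 * S.Mt L w.1.1 w.1.2 h s))]
  refine Finset.sum_congr rfl fun βγ _ => ?_
  rw [Finset.sum_mul, coeff_sum]
  refine Finset.sum_congr rfl fun i _ => ?_
  rw [show monomial (consExp 0 (natOf i)) (p (βγ, i)) =
      C (p (βγ, i)) * monomial (consExp 0 (natOf i)) 1 by rw [C_mul_monomial, mul_one],
    mul_assoc, coeff_C_mul]

/-! ### Siegel's step (Lemme 1) -/

/-- The equations of Siegel's system: a point `h ∈ [0,M)ⁿ`, an order `s < T'`, and a monomial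
`w^e X^v` with `e < d`, `vⱼ < b + DM`. [cite: Ably1994, §II Lemme 1 p. 35 (the system (S))] -/
abbrev EqIdx (S : Setup) (D b M T' : ℕ) : Type :=
  (Fin S.n → Fin M) × Fin T' × Fin S.d × (Fin S.n → Fin (b + D * M))

/-- The matrix of Siegel's system: the coefficient of `w^e X^v` in `X^i M̃_{β,γ,h,s}`.
[cite: Ably1994, §II Lemme 1 p. 35 (the coefficients `m_{β,γ,s,h,j}`)] -/
def mat {M T' : ℕ} (r : EqIdx S D b M T') (w : Unk S.n L D b) : ℤ :=
  coeff (consExp (r.2.2.1 : ℕ) (natOf r.2.2.2))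
    (monomial (consExp 0 (natOf w.2)) 1 * S.Mt L w.1.1 w.1.2 (natOf r.1) r.2.1)

/-- A coefficient is bounded by the `ℓ¹`-norm. [folklore] -/
theorem abs_coeff_le_l1 {σ : Type*} (P : MvPolynomial σ ℤ) (m : σ →₀ ℕ) :
    |((coeff m P : ℤ) : ℝ)| ≤ l1 P := by
  have := le_wnorm (normRingSeminorm ℤ) P m
  rwa [normRingSeminorm_int_apply] at this

/-- **Entries of Siegel's system**: `|entry| ≤ (L + D)^{T'} K₁(M)^L`.
[cite: Ably1994, §II Lemme 1 p. 35] -/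
theorem abs_mat_le {M T' : ℕ} (r : EqIdx S D b M T') (w : Unk S.n L D b) :
    |(S.mat r w : ℝ)| ≤ ((L : ℝ) + D) ^ T' * S.K₁ M ^ L := by
  have hK := S.one_le_K₁ M
  unfold mat
  refine (abs_coeff_le_l1 _ _).trans ?_
  refine (wnorm_mul_le _ _ _).trans ?_
  rw [wnorm_monomial, Chudnovsky.normRingSeminorm_int_one, one_mul]
  refine (S.l1_Mt_le w.1.1.isLt _ (fun j => (natOf_lt r.1 j).le) _).trans ?_
  have hβγ : ((w.1.1 : ℕ) : ℝ) + ((w.1.2 : ℕ) : ℝ) ≤ (L : ℝ) + D := by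
    have h1 : ((w.1.1 : ℕ) : ℝ) ≤ L := by exact_mod_cast w.1.1.isLt.le
    have h2 : ((w.1.2 : ℕ) : ℝ) ≤ D := by exact_mod_cast w.1.2.isLt.le
    linarith
  refine mul_le_mul_of_nonneg_right ?_ (pow_nonneg (zero_le_one.trans hK) _)
  calc (((w.1.1 : ℕ) : ℝ) + ((w.1.2 : ℕ) : ℝ)) ^ (r.2.1 : ℕ) ≤ ((L : ℝ) + D) ^ (r.2.1 : ℕ) :=
        pow_le_pow_left₀ (by positivity) hβγ _
    _ ≤ ((L : ℝ) + D) ^ T' := by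
        refine pow_le_pow_right₀ ?_ r.2.1.isLt.le
        have : (1 : ℝ) ≤ L := by
          have := w.1.1.isLt
          exact_mod_cast (show 1 ≤ L by omega)
        have : (0 : ℝ) ≤ D := Nat.cast_nonneg _
        linarith

/-- `#Unk = L D bⁿ`. [folklore] -/
theorem card_Unk : Fintype.card (Unk S.n L D b) = L * D * b ^ S.n := by
  simp only [Fintype.card_prod, Fintype.card_fin, Fintype.card_fun]

/-- `#EqIdx = Mⁿ T' d (b + DM)ⁿ`. [folklore] -/
theorem card_EqIdx (M T' : ℕ) :
    Fintype.card (EqIdx S D b M T') = M ^ S.n * (T' * (S.d * (b + D * M) ^ S.n)) := by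
  simp only [Fintype.card_prod, Fintype.card_fin, Fintype.card_fun]

/-- **Lemme 1 (Siegel's step).** If `L, D, M, T' ≥ 1` and
(C₁) `2 Mⁿ T' d (b + DM)ⁿ ≤ L D bⁿ`, there are integers `p_{(β,γ),i}`, not all zero, with
`|p| ≤ #Unk · (L + D)^{T'} K₁(M)^L`, such that `Q_{s,h} = 0` identically for all `h ∈ [0,M)ⁿ`
and `s < T'` (so that `Q_{s,h}(α, z) = 0` for every `z`; Ably obtains `Q_{s,h}(α, ·) = 0` from
Siegel's lemma over `K`, [Wa2] Lemme 1.3.1). [cite: Ably1994, §II Lemme 1 p. 35] -/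
theorem exists_coeffs {M T' : ℕ} (hL : 1 ≤ L) (hD : 1 ≤ D) (hT' : 1 ≤ T') (hM : 1 ≤ M)
    (hC1 : 2 * (M ^ S.n * (T' * (S.d * (b + D * M) ^ S.n))) ≤ L * D * b ^ S.n) :
    ∃ p : Unk S.n L D b → ℤ, p ≠ 0 ∧
      (∀ w, |(p w : ℝ)| ≤ (Fintype.card (Unk S.n L D b) : ℝ) *
        (((L : ℝ) + D) ^ T' * S.K₁ M ^ L)) ∧
      ∀ h : Fin S.n → ℕ, (∀ j, h j < M) → ∀ s < T', S.Q p h s = 0 := by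
  classical
  set NE := Fintype.card (EqIdx S D b M T') with hNE
  set NU := Fintype.card (Unk S.n L D b) with hNU
  have h2 : 2 * NE ≤ NU := by rw [hNE, hNU, card_EqIdx, card_Unk]; exact hC1
  have hNEpos : 0 < NE := by
    rw [hNE, card_EqIdx]
    have := S.one_le_d
    have : 0 < b + D * M := by
      have : 0 < D * M := Nat.mul_pos hD hM
      omega
    positivity
  have hlt : NE < NU := by omega
  set eE := Fintype.equivFin (EqIdx S D b M T')
  set eU := Fintype.equivFin (Unk S.n L D b)
  set U : ℝ := ((L : ℝ) + D) ^ T' * S.K₁ M ^ L with hU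
  have hU1 : 1 ≤ U := by
    have h1 : (1 : ℝ) ≤ (L : ℝ) + D := by
      have : (1 : ℝ) ≤ L := by exact_mod_cast hL
      have : (0 : ℝ) ≤ D := Nat.cast_nonneg _
      linarith
    exact one_le_mul_of_one_le_of_one_le (one_le_pow₀ h1) (one_le_pow₀ (S.one_le_K₁ M))
  obtain ⟨xv, hx0, hxb, hxe⟩ := Literature.NumberTheory.Transcendental.Baker1975.lemma1 hNEpos hlt
    hU1 (fun i j => S.mat (eE.symm i) (eU.symm j)) (fun i j => S.abs_mat_le _ _)
  refine ⟨fun w => xv (eU w), ?_, ?_, ?_⟩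
  · intro h0
    apply hx0
    funext j
    have := congrFun h0 (eU.symm j)
    simpa using this
  · intro w
    refine (hxb (eU w)).trans ?_
    have hbase : (1 : ℝ) ≤ NU * U := by
      have : (1 : ℝ) ≤ NU := by exact_mod_cast (show 1 ≤ NU by omega)
      nlinarith
    have hexp1 : (NE : ℝ) / (NU - NE) ≤ 1 := by
      rw [div_le_one]
      · have : ((2 * NE : ℕ) : ℝ) ≤ NU := by exact_mod_cast h2
        push_cast at this
        linarith
      · have : ((NE : ℕ) : ℝ) < NU := by exact_mod_cast hlt
        linarith
    calc ((NU : ℝ) * U) ^ ((NE : ℝ) / (NU - NE)) ≤ ((NU : ℝ) * U) ^ (1 : ℝ) :=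
          Real.rpow_le_rpow_of_exponent_le hbase hexp1
      _ = NU * U := Real.rpow_one _
  · intro h hh s hs
    ext m
    rw [coeff_zero]
    by_cases hsmall : m 0 < S.d ∧ ∀ j : Fin S.n, m j.succ < b + D * M
    · -- an equation of the system
      set h' : Fin S.n → Fin M := fun j => ⟨h j, hh j⟩
      set s' : Fin T' := ⟨s, hs⟩
      set e' : Fin S.d := ⟨m 0, hsmall.1⟩
      set v' : Fin S.n → Fin (b + D * M) := fun j => ⟨m j.succ, hsmall.2 j⟩
      have hm : m = consExp (e' : ℕ) (natOf v') := by
        ext i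
        refine Fin.cases ?_ (fun j => ?_) i
        · simp [e']
        · simp [v', natOf]
      have hhn : h = natOf h' := rfl
      rw [coeff_Q, hm, hhn]
      have := hxe (eE (h', s', e', v'))
      simp only [Equiv.symm_apply_apply] at this
      rw [← Equiv.sum_comp eU.symm (fun w : Unk S.n L D b =>
        xv (eU w) * coeff (consExp (e' : ℕ) (natOf v'))
          (monomial (consExp 0 (natOf w.2)) 1 * S.Mt L w.1.1 w.1.2 (natOf h') (s' : ℕ)))]
      rw [← this]
      refine Finset.sum_congr rfl fun j _ => ?_
      simp only [Equiv.apply_symm_apply, mat]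
      ring
    · -- not a monomial of `Q_{s,h}`
      have hnot : m ∉ (S.Q (fun w => xv (eU w)) h s).support := fun hm =>
        hsmall (S.mem_support_Q _ hh s hm)
      exact MvPolynomial.notMem_support_iff.mp hnot

/-! ### The modification (Diaz): minimal Taylor index and the exact vanishing -/

/-- `P_{β,γ,j} = taylorCoeff j P_{β,γ} ∈ ℤ[w, X]` (`= (1/j!) ∂^j P_{β,γ}`, Ably's `D^j P_{β,γ}`).
[cite: Ably1994, §II "Modification" p. 36] -/
def Pj (p : Unk S.n L D b → ℤ) (βγ : Fin L × Fin D) (j : Fin (S.n + 1) →₀ ℕ) :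
    MvPolynomial (Fin (S.n + 1)) ℤ :=
  taylorCoeff j (S.P p βγ)

/-- **The family** `Q_{s,h,j} = ∑_{β,γ} P_{β,γ,j} M̃_{β,γ,h,s} ∈ ℤ[w, X]`.
[cite: Ably1994, §II "Modification" p. 36] -/
def Qj (p : Unk S.n L D b → ℤ) (h : Fin S.n → ℕ) (s : ℕ) (j : Fin (S.n + 1) →₀ ℕ) :
    MvPolynomial (Fin (S.n + 1)) ℤ :=
  ∑ βγ : Fin L × Fin D, S.Pj p βγ j * S.Mt L βγ.1 βγ.2 h s

/-- **Minimal index at a point** `x` (Ably's `j = j(θ̃)`, p. 36): some `P_{β,γ,j}(x) ≠ 0` while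
all `P_{β,γ,j'}(x) = 0` for `|j'| < |j|`. [cite: Ably1994, §II "Modification" p. 36] -/
def IsMinIdx (p : Unk S.n L D b → ℤ) (x : Fin (S.n + 1) → ℂ) (j : Fin (S.n + 1) →₀ ℕ) : Prop :=
  (∃ βγ, aeval x (S.Pj p βγ j) ≠ 0) ∧ ∀ βγ j', degree j' < degree j → aeval x (S.Pj p βγ j') = 0

/-- **Existence of a minimal index at every point**, as soon as `p ≠ 0`.
[cite: Ably1994, §II "Modification" p. 36] -/
theorem exists_isMinIdx {p : Unk S.n L D b → ℤ} (hp : p ≠ 0) (x : Fin (S.n + 1) → ℂ) :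
    ∃ j, S.IsMinIdx p x j := by
  classical
  obtain ⟨a₀, ha₀⟩ : ∃ βγ, S.P p βγ ≠ 0 := by
    by_contra h
    push Not at h
    exact hp (S.eq_zero_of_P_eq_zero h)
  have hex : ∃ N : ℕ, ∃ βγ j, degree j = N ∧ aeval x (S.Pj p βγ j) ≠ 0 := by
    by_contra h
    push Not at h
    apply ha₀
    refine eq_zero_of_forall_eval₂_taylorCoeff (f := algebraMap ℤ ℂ)
      (RingHom.injective_int (algebraMap ℤ ℂ)) x fun j => ?_
    have := h (degree j) a₀ j rfl
    simpa [Pj, MvPolynomial.aeval_def] using this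
  obtain ⟨βγ, j, hj, hne⟩ := Nat.find_spec hex
  refine ⟨j, ⟨βγ, hne⟩, fun βγ' j' hlt => ?_⟩
  by_contra hne'
  have : Nat.find hex ≤ degree j' := Nat.find_min' hex ⟨βγ', j', rfl, hne'⟩
  rw [hj] at hlt
  omega

/-- **The exact vanishing at the perturbed point** (Diaz's key identity; Ably p. 37,
"De la définition de `j`, on tire l'égalité `Q_{s,h,j}(θ̃) = (D^jQ_{s,h})(θ̃)`"): if `Q_{s,h} = 0`
identically and `j` is minimal at `x`, then `Q_{s,h,j}(x) = 0`. [cite: Ably1994, §II Lemme 2 p. 37] -/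
theorem aeval_Qj_eq_zero_of_isMinIdx {p : Unk S.n L D b → ℤ} {h : Fin S.n → ℕ} {s : ℕ}
    (hQ : S.Q p h s = 0) {x : Fin (S.n + 1) → ℂ} {j : Fin (S.n + 1) →₀ ℕ}
    (hj : S.IsMinIdx p x j) : aeval x (S.Qj p h s j) = 0 := by
  classical
  have := sum_eval_taylorCoeff_mul_eq_zero (algebraMap ℤ ℂ) x Finset.univ (S.P p)
    (fun βγ => S.Mt L βγ.1 βγ.2 h s) (by simpa [Q] using hQ) j
    (fun βγ _ j' hj' => by
      have := hj.2 βγ j' hj'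
      simpa [Pj, MvPolynomial.aeval_def] using this)
  simpa [Qj, Pj, MvPolynomial.aeval_def, map_sum, map_mul] using this


/-! ### Sizes of `P_{β,γ,j}` and `Q_{s,h,j}` -/

/-- `deg P_{β,γ} ≤ n (b - 1)`. [folklore] -/
theorem totalDegree_P_le (p : Unk S.n L D b → ℤ) (βγ : Fin L × Fin D) :
    (S.P p βγ).totalDegree ≤ S.n * (b - 1) := by
  classical
  unfold P
  refine totalDegree_finsetSum_le fun i _ => (totalDegree_monomial_le _ _).trans ?_
  rw [sum_consExp', zero_add]
  calc ∑ j, natOf i j ≤ ∑ _j : Fin S.n, (b - 1) :=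
        Finset.sum_le_sum fun j _ => by have := (i j).isLt; simp only [natOf]; omega
    _ = S.n * (b - 1) := by simp

/-- `deg P_{β,γ,j} ≤ n (b - 1)`. [cite: Ably1994, §II p. 36 ("de degrés majorés")] -/
theorem totalDegree_Pj_le (p : Unk S.n L D b → ℤ) (βγ : Fin L × Fin D)
    (j : Fin (S.n + 1) →₀ ℕ) : (S.Pj p βγ j).totalDegree ≤ S.n * (b - 1) := by
  classical
  exact (totalDegree_taylorCoeff_le j (S.P p βγ)).trans (S.totalDegree_P_le p βγ)

/-- A minimal index has length `≤ n (b - 1)`. [folklore] -/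
theorem degree_le_of_isMinIdx {p : Unk S.n L D b → ℤ} {x : Fin (S.n + 1) → ℂ}
    {j : Fin (S.n + 1) →₀ ℕ} (hj : S.IsMinIdx p x j) : degree j ≤ S.n * (b - 1) := by
  classical
  obtain ⟨βγ, hβγ⟩ := hj.1
  by_contra hlt
  apply hβγ
  have : S.Pj p βγ j = 0 :=
    taylorCoeff_eq_zero_of_lt j (S.P p βγ) (by have := S.totalDegree_P_le p βγ; omega)
  rw [this, map_zero]

/-- `‖P_{β,γ}‖₁ ≤ bⁿ H` when all unknowns are `≤ H` in absolute value. [folklore] -/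
theorem l1_P_le (p : Unk S.n L D b → ℤ) {H : ℝ} (hH : ∀ w, |(p w : ℝ)| ≤ H)
    (βγ : Fin L × Fin D) : l1 (S.P p βγ) ≤ (b : ℝ) ^ S.n * H := by
  unfold P
  refine (wnorm_sum_le _ _ _).trans ?_
  calc ∑ i : Fin S.n → Fin b, wnorm (normRingSeminorm ℤ) (monomial (consExp 0 (natOf i)) (p (βγ, i)))
      ≤ ∑ _i : Fin S.n → Fin b, H := Finset.sum_le_sum fun i _ => by
        rw [wnorm_monomial, normRingSeminorm_int_apply]; exact hH (βγ, i)
    _ = (b : ℝ) ^ S.n * H := by simp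

/-- **`‖P_{β,γ,j}‖₁ ≤ 2^{n(b-1)} bⁿ H`** (Ably: `H(D^jP) ≤ 2^{deg P} H(P)`, p. 36).
[cite: Ably1994, §II Lemme 2 p. 36] -/
theorem l1_Pj_le (p : Unk S.n L D b → ℤ) {H : ℝ} (hH : ∀ w, |(p w : ℝ)| ≤ H)
    (βγ : Fin L × Fin D) (j : Fin (S.n + 1) →₀ ℕ) :
    l1 (S.Pj p βγ j) ≤ 2 ^ (S.n * (b - 1)) * ((b : ℝ) ^ S.n * H) := by
  classical
  unfold Pj
  refine (l1_taylorCoeff_le j (S.P p βγ)).trans ?_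
  exact mul_le_mul (pow_le_pow_right₀ (by norm_num) (S.totalDegree_P_le p βγ))
    (S.l1_P_le p hH βγ) (wnorm_nonneg _ _) (by positivity)

/-- **`deg Q_{s,h,j} ≤ n(b - 1) + d - 1 + (D - 1) n (M - 1)`** for `hⱼ < M` (Ably: `≤ 2nDM`).
[cite: Ably1994, §II (9) p. 41] -/
theorem totalDegree_Qj_le (p : Unk S.n L D b → ℤ) {M : ℕ} {h : Fin S.n → ℕ}
    (hh : ∀ j, h j < M) (s : ℕ) (j : Fin (S.n + 1) →₀ ℕ) :
    (S.Qj p h s j).totalDegree ≤ S.n * (b - 1) + (S.d - 1 + (D - 1) * (S.n * (M - 1))) := by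
  classical
  unfold Qj
  refine totalDegree_finsetSum_le fun βγ _ => (totalDegree_mul _ _).trans ?_
  refine Nat.add_le_add (S.totalDegree_Pj_le p βγ j) ?_
  refine (S.totalDegree_Mt_le L βγ.1 βγ.2 h s).trans (Nat.add_le_add_left ?_ _)
  calc (βγ.2 : ℕ) * ∑ i, h i ≤ (D - 1) * ∑ _i : Fin S.n, (M - 1) := by
        refine Nat.mul_le_mul (by have := βγ.2.isLt; omega) (Finset.sum_le_sum fun i _ => ?_)
        have := hh i; omega
    _ = (D - 1) * (S.n * (M - 1)) := by simp

/-- **`‖Q_{s,h,j}‖₁ ≤ L D · 2^{n(b-1)} bⁿ H · (L + D)^s K₁(M)^L`** for `hⱼ < M`.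
[cite: Ably1994, §II (10) p. 41] -/
theorem l1_Qj_le (p : Unk S.n L D b → ℤ) {H : ℝ} (hH0 : 0 ≤ H) (hH : ∀ w, |(p w : ℝ)| ≤ H)
    {M : ℕ} {h : Fin S.n → ℕ} (hh : ∀ j, h j < M) (s : ℕ) (j : Fin (S.n + 1) →₀ ℕ) :
    l1 (S.Qj p h s j) ≤ (L : ℝ) * D * ((2 ^ (S.n * (b - 1)) * ((b : ℝ) ^ S.n * H)) *
      (((L : ℝ) + D) ^ s * S.K₁ M ^ L)) := by
  classical
  have hK := S.one_le_K₁ M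
  set A : ℝ := 2 ^ (S.n * (b - 1)) * ((b : ℝ) ^ S.n * H) with hA
  set B : ℝ := ((L : ℝ) + D) ^ s * S.K₁ M ^ L with hB
  have hA0 : 0 ≤ A := by positivity
  unfold Qj
  refine (wnorm_sum_le _ _ _).trans ?_
  have hterm : ∀ βγ : Fin L × Fin D, l1 (S.Pj p βγ j * S.Mt L βγ.1 βγ.2 h s) ≤ A * B := by
    intro βγ
    refine (wnorm_mul_le _ _ _).trans ?_
    refine mul_le_mul (S.l1_Pj_le p hH βγ j) ?_ (wnorm_nonneg _ _) hA0
    refine (S.l1_Mt_le βγ.1.isLt βγ.2 (fun i => (hh i).le) s).trans ?_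
    refine mul_le_mul_of_nonneg_right (pow_le_pow_left₀ (by positivity) ?_ _)
      (pow_nonneg (zero_le_one.trans hK) _)
    have h1 : ((βγ.1 : ℕ) : ℝ) ≤ L := by exact_mod_cast βγ.1.isLt.le
    have h2 : ((βγ.2 : ℕ) : ℝ) ≤ D := by exact_mod_cast βγ.2.isLt.le
    linarith
  calc ∑ βγ : Fin L × Fin D, wnorm (normRingSeminorm ℤ) (S.Pj p βγ j * S.Mt L βγ.1 βγ.2 h s)
      ≤ ∑ _βγ : Fin L × Fin D, A * B := Finset.sum_le_sum fun βγ _ => hterm βγ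
    _ = (L : ℝ) * D * (A * B) := by
        simp [Finset.sum_const, Finset.card_univ, Fintype.card_prod, Fintype.card_fin, mul_assoc]


end Setup

end LWMeasure

end Literature.NumberTheory.Transcendental

end
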